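import Summits.Ventures.PercRepro.GenQChargeBounds
import Summits.Ventures.PercRepro.GenQOpenLayersCoreSmall
import Summits.Ventures.PercRepro.GenQSevenFiveColoopFree

/-!
# PercRepro — THE `t = 2` CLAUSE OF THE `(7, 5)` RESIDUE ON THE CORE, IN THE KERNEL (night-4, gen 3; sheet §48)

The type-`2` balance `0 ≤ Jq M G 5 2` on every rank-`5` flat `G` with at most `10` points of a matroid whose lines have
at most `3` points (in particular every Core matroid), by the charging form `Jq_two_nonneg_of_charge`
(`GenQChargeTwo.lean`): a demanding basis `B₀` (`w = −1/3`) is charged at least `1/3` by the singletons `B₀ ∪ {x}` and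
the pairs `B₀ ∪ {x, y}` of `G ∖ B₀` alone.  With `C_x` the fundamental circuit of `x`:

* a singleton charges `(5/(7 − #C_x) − (7/6)·dem)/#C_x` — at least `1/36` if `#C_x = 3`, at least `1/8` otherwise
  (`5/12` when the singleton is demand-free);
* a pair with `#C_x = 3` charges at least `(5/3 − (7/6)·dem)/13`: `#(C_x ∪ C_y) ≥ 5` (no `4`-point line), so the pair
  has at most `2` coloops, and the `5`-subsets containing `C_x` or `C_y` are dependent;
* with `k = #(G ∖ B₀) ∈ [2, 5]` and `k₃` points of circuit size `3`, the total is at least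
  `k₃·σ₃ + (k − k₃)·σ₄ + (C(k, 2) − C(k − k₃, 2))·τ ≥ 1/3` in every case (`sevenFive_charge_ge`).

Main statements: `jq_two_nonneg_of_lines_five` (lines `≤ 3` points), `jq_two_nonneg_of_core_five` (Core matroids),
`SevenFiveTypeThreeCoreFree` and `sevenFiveLowLayersCoreFree_of_typeThree`: the coloop-free low layers of `(7, 5)` are
now exactly their `t = 3` clause.
-/

namespace PercRepro.GenQ

open Finset ThmH PerFlat SixFour ThmN NightThree

variable {α : Type*} [DecidableEq α] {M : Matroid α} [M.Finite]

/-! ## The share from a pair at `q = 5` -/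

/-- **The share of `B₀` from `B₀ ∪ {x, y}` when `#C_x = 3`** (lines `≤ 3` points): at least
`(5/3 − (7/6)·dem(B₀ ∪ {x, y}))/13`. -/
theorem pair_share_ge_of_three (hs : Simple M) (hline : ∀ L ∈ flatsQ M 2, L.card ≤ 3) {G B₀ : Finset α}
    (hG : G ⊆ gr M) (hrG : M.eRk (G : Set α) = ((5 : ℕ) : ℕ∞)) (hB : B₀ ∈ basesOf M G 5) {x y : α} (hx : x ∈ G)
    (hxB : x ∉ B₀) (hy : y ∈ G) (hyB : y ∉ B₀) (hxy : x ≠ y) (hcx : (fc M x B₀).card = 3) :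
    (5 / 3 - 7 / 6 * dem M G 2 (insert x (insert y B₀))) / 13 ≤
      wTwo M G (insert x (insert y B₀)) 5 / nb M G (insert x (insert y B₀)) 5 := by
  set S := insert x (insert y B₀) with hSdef
  obtain ⟨hBG, hr, hc⟩ := mem_basesOf.1 hB
  have hR : S ∈ Rq M G 5 := pair_mem_Rq hrG hB hx hy
  have hxS : x ∉ insert y B₀ := fun h' => by
    rcases Finset.mem_insert.1 h' with h'' | h''
    · exact hxy h''
    · exact hxB h''
  have hcardS : S.card = 7 := by
    rw [hSdef, Finset.card_insert_of_notMem hxS, Finset.card_insert_of_notMem hyB, hc]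
  have hw0 : 0 ≤ wTwo M G S 5 := wTwo_nonneg_of_card_ne hs hG (by norm_num) hR (by rw [hcardS]; norm_num)
  have hnb1 := one_le_nb hR
  have hU := five_le_card_union_fc hs hline hG hrG hB (by norm_num) hx hxB hy hyB hxy
  have hm := mTr_pair_le hG hrG hB hx hxB hy hyB hxy
  have hnb := nb_pair_le hG hrG hB hx hxB hy hyB hxy hU
  rw [← hSdef] at hm hnb
  have h21 : (5 + 2).choose 5 = 21 := by decide
  -- the `5`-subsets of `S` containing `C_x`: `C(4, 2) = 6`
  have hCxS : fc M x B₀ ⊆ S :=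
    (fc_subset_insert x B₀).trans (Finset.insert_subset_insert x (Finset.subset_insert y B₀))
  have hCyS : fc M y B₀ ⊆ S := (fc_subset_insert y B₀).trans (Finset.subset_insert x _)
  have hA : ((S.powersetCard 5).filter (fun T => fc M x B₀ ⊆ T)).card = 6 := by
    rw [Finset.card_filter_powersetCard_subset _ _ _ hCxS (by rw [hcx]; norm_num), hcardS, hcx]
    rfl
  -- the circuit of `y`: `3 ≤ #C_y ≤ 6`, and `#(C_x ∪ C_y) ≥ #C_y + 1`
  have hne : B₀.Nonempty := Finset.card_pos.1 (by omega)
  have h3y := three_le_card_fc hs (hBG.trans hG) (hG hy) (indep_of_mem_basesOf hB)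
    (mem_closure_of_mem_basesOf hG hrG hB hy) hyB hne
  have hcy6 : (fc M y B₀).card ≤ 6 := by
    have := card_fc_le (M := M) y B₀
    omega
  have hxD : x ∉ fc M y B₀ := fun h => by
    rcases Finset.mem_insert.1 (fc_subset_insert y B₀ h) with h' | h'
    · exact hxy h'
    · exact hxB h'
  have hUy : (fc M y B₀).card + 1 ≤ (fc M x B₀ ∪ fc M y B₀).card := by
    have : insert x (fc M y B₀) ⊆ fc M x B₀ ∪ fc M y B₀ :=
      Finset.insert_subset (Finset.mem_union.2 (Or.inl (mem_fc_self x B₀))) Finset.subset_union_right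
    have h := Finset.card_le_card this
    rwa [Finset.card_insert_of_notMem hxD] at h
  -- real-number bookkeeping
  have hnbpos : (0 : ℚ) < nb M G S 5 := by exact_mod_cast (by omega : 0 < nb M G S 5)
  have hdem0 := dem_nonneg (M := M) G S 2
  have hdem1 := dem_le_one (M := M) G S 2
  have hwTwo : wTwo M G S 5 = 5 * (1 / (1 + (mTr M S : ℚ))) - 7 / 6 * dem M G 2 S := by
    unfold wTwo wInf
    push_cast
    ring
  -- the union has `5`, `6` or `7` points; `m ≤ 7 − #(C ∪ D)`
  rcases (show (fc M x B₀ ∪ fc M y B₀).card = 5 ∨ 6 ≤ (fc M x B₀ ∪ fc M y B₀).card by omega) with hU5 | hU6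
  · -- `#(C ∪ D) = 5`: `#C_y ≤ 4`, so `#{T ⊇ C_y} ≥ 3` and `nb ≤ 13`; `m ≤ 2`
    have hcy4 : (fc M y B₀).card ≤ 4 := by omega
    have hD : ((S.powersetCard 5).filter (fun T => fc M y B₀ ⊆ T)).card =
        (7 - (fc M y B₀).card).choose (5 - (fc M y B₀).card) := by
      rw [Finset.card_filter_powersetCard_subset _ _ _ hCyS (by omega), hcardS]
    have hD3 : 3 ≤ ((S.powersetCard 5).filter (fun T => fc M y B₀ ⊆ T)).card := by
      rw [hD]
      rcases (show (fc M y B₀).card = 3 ∨ (fc M y B₀).card = 4 by omega) with h | h <;> rw [h] <;> decide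
    have hnb13 : (nb M G S 5 : ℚ) ≤ 13 := by exact_mod_cast (by omega : nb M G S 5 ≤ 13)
    have hm2 : (mTr M S : ℚ) ≤ 2 := by exact_mod_cast (by omega : mTr M S ≤ 2)
    have hwinf : (1 : ℚ) / 3 ≤ 1 / (1 + (mTr M S : ℚ)) :=
      one_div_le_one_div_of_le (by positivity) (by linarith)
    have hwlow : 5 / 3 - 7 / 6 * dem M G 2 S ≤ wTwo M G S 5 := by
      rw [hwTwo]
      linarith
    calc (5 / 3 - 7 / 6 * dem M G 2 S) / 13 ≤ wTwo M G S 5 / 13 :=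
          div_le_div_of_nonneg_right hwlow (by norm_num)
      _ ≤ wTwo M G S 5 / nb M G S 5 := div_le_div_of_nonneg_left hw0 hnbpos hnb13
  · -- `#(C ∪ D) ≥ 6`: `nb ≤ 16` and `m ≤ 1`
    have hnb16 : (nb M G S 5 : ℚ) ≤ 16 := by exact_mod_cast (by omega : nb M G S 5 ≤ 16)
    have hm1 : (mTr M S : ℚ) ≤ 1 := by exact_mod_cast (by omega : mTr M S ≤ 1)
    have hwinf : (1 : ℚ) / 2 ≤ 1 / (1 + (mTr M S : ℚ)) :=
      one_div_le_one_div_of_le (by positivity) (by linarith)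
    have hwlow : 5 / 2 - 7 / 6 * dem M G 2 S ≤ wTwo M G S 5 := by
      rw [hwTwo]
      linarith
    calc (5 / 3 - 7 / 6 * dem M G 2 S) / 13 ≤ (5 / 2 - 7 / 6 * dem M G 2 S) / 16 := by
          rw [div_le_div_iff₀ (by norm_num) (by norm_num)]
          linarith
      _ ≤ wTwo M G S 5 / 16 := div_le_div_of_nonneg_right hwlow (by norm_num)
      _ ≤ wTwo M G S 5 / nb M G S 5 := div_le_div_of_nonneg_left hw0 hnbpos hnb16

/-! ## The singletons at `q = 5` -/

/-- The share from `B₀ ∪ {x}` with `#C_x = 3`: at least `(5/4 − (7/6)·dem)/3`. -/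
theorem single_share_five_of_three (hs : Simple M) {G B₀ : Finset α} (hG : G ⊆ gr M)
    (hrG : M.eRk (G : Set α) = ((5 : ℕ) : ℕ∞)) (hB : B₀ ∈ basesOf M G 5) {x : α} (hx : x ∈ G) (hxB : x ∉ B₀)
    (hcx : (fc M x B₀).card = 3) :
    (5 / 4 - 7 / 6 * dem M G 2 (insert x B₀)) / 3 ≤ wTwo M G (insert x B₀) 5 / nb M G (insert x B₀) 5 := by
  have h := single_share_ge hs hG hrG hB (by norm_num) hx hxB
  rw [hcx] at h
  norm_num at h
  linarith

/-- The share from `B₀ ∪ {x}` with `#C_x ≥ 4`: at least `(5/3 − (7/6)·dem)/4`. -/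
theorem single_share_five_of_ge_four (hs : Simple M) {G B₀ : Finset α} (hG : G ⊆ gr M)
    (hrG : M.eRk (G : Set α) = ((5 : ℕ) : ℕ∞)) (hB : B₀ ∈ basesOf M G 5) {x : α} (hx : x ∈ G) (hxB : x ∉ B₀)
    (hcx : 4 ≤ (fc M x B₀).card) :
    (5 / 3 - 7 / 6 * dem M G 2 (insert x B₀)) / 4 ≤ wTwo M G (insert x B₀) 5 / nb M G (insert x B₀) 5 := by
  have h := single_share_ge hs hG hrG hB (by norm_num) hx hxB
  have hc6 : (fc M x B₀).card ≤ 6 := by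
    have := card_fc_le (M := M) x B₀
    rw [(mem_basesOf.1 hB).2.2] at this
    omega
  have hd0 := dem_nonneg (M := M) G (insert x B₀) 2
  rcases (show (fc M x B₀).card = 4 ∨ (fc M x B₀).card = 5 ∨ (fc M x B₀).card = 6 by omega) with h4 | h5 | h6
  · rw [h4] at h
    norm_num at h
    linarith
  · rw [h5] at h
    norm_num at h
    linarith
  · rw [h6] at h
    norm_num at h
    linarith

/-! ## The two layers summed -/

/-- `B₀ ∪ {x, y} = insert x (insert y B₀)`. -/
theorem union_pair_eq_insert (B₀ : Finset α) (x y : α) : B₀ ∪ {x, y} = insert x (insert y B₀) := by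
  ext e
  simp only [Finset.mem_union, Finset.mem_insert, Finset.mem_singleton]
  tauto

/-- The pairs of `K` meeting `K₃ ⊆ K`: `#{P : P ∩ K₃ ≠ ∅} + C(#K − #K₃, 2) = C(#K, 2)`. -/
theorem card_pairs_meet {K K₃ : Finset α} (hK₃ : K₃ ⊆ K) :
    ((K.powersetCard 2).filter (fun P => (P ∩ K₃).Nonempty)).card + (K.card - K₃.card).choose 2 =
      K.card.choose 2 := by
  have h := Finset.card_filter_add_card_filter_not (s := K.powersetCard 2) (fun P => (P ∩ K₃).Nonempty)
  have hneg : (K.powersetCard 2).filter (fun P => ¬ (P ∩ K₃).Nonempty) = (K \ K₃).powersetCard 2 := by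
    ext P
    rw [Finset.mem_filter, Finset.mem_powersetCard, Finset.mem_powersetCard, Finset.not_nonempty_iff_eq_empty]
    constructor
    · rintro ⟨⟨hPK, hPc⟩, hPe⟩
      refine ⟨fun e he => Finset.mem_sdiff.2 ⟨hPK he, fun he₃ => ?_⟩, hPc⟩
      have : e ∈ P ∩ K₃ := Finset.mem_inter.2 ⟨he, he₃⟩
      rw [hPe] at this
      exact Finset.notMem_empty e this
    · rintro ⟨hPK, hPc⟩
      refine ⟨⟨hPK.trans Finset.sdiff_subset, hPc⟩, ?_⟩
      ext e
      rw [Finset.mem_inter]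
      exact ⟨fun he => absurd he.2 (Finset.mem_sdiff.1 (hPK he.1)).2, fun he => absurd he (Finset.notMem_empty e)⟩
  rw [hneg, Finset.card_powersetCard, Finset.card_sdiff_of_subset hK₃, Finset.card_powersetCard] at h
  exact h

/-- **The singletons sum**: with `K = G ∖ B₀`, `K₃` its points of circuit size `3` and `D₁ = 0` if `#K ≤ 2`, `1`
otherwise, `Σ_x share(x) ≥ #K₃·(5/4 − (7/6)D₁)/3 + (#K − #K₃)·(5/3 − (7/6)D₁)/4`. -/
theorem singles_sum_ge (hs : Simple M) {G B₀ : Finset α} (hG : G ⊆ gr M)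
    (hrG : M.eRk (G : Set α) = ((5 : ℕ) : ℕ∞)) (hB : B₀ ∈ basesOf M G 5) :
    (((G \ B₀).filter (fun x => (fc M x B₀).card = 3)).card : ℚ) *
        ((5 / 4 - 7 / 6 * (if (G \ B₀).card ≤ 2 then (0 : ℚ) else 1)) / 3) +
      (((G \ B₀).card - ((G \ B₀).filter (fun x => (fc M x B₀).card = 3)).card : ℕ) : ℚ) *
        ((5 / 3 - 7 / 6 * (if (G \ B₀).card ≤ 2 then (0 : ℚ) else 1)) / 4) ≤
      ∑ x ∈ G \ B₀, wTwo M G (insert x B₀) 5 / nb M G (insert x B₀) 5 := by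
  set K := G \ B₀ with hK
  set K₃ := K.filter (fun x => (fc M x B₀).card = 3) with hK₃
  set D₁ : ℚ := if K.card ≤ 2 then 0 else 1 with hD₁
  have hK₃K : K₃ ⊆ K := Finset.filter_subset _ _
  -- the demand of a singleton is at most `D₁`
  have hdemD : ∀ x ∈ K, dem M G 2 (insert x B₀) ≤ D₁ := by
    intro x hxK
    rw [hD₁]
    split_ifs with hk
    · rw [dem_two_eq_zero_of_card_le_one]
      have : G \ insert x B₀ = K.erase x := by
        ext e
        simp only [Finset.mem_sdiff, Finset.mem_insert, Finset.mem_erase, hK]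
        tauto
      rw [this, Finset.card_erase_of_mem hxK]
      omega
    · exact dem_le_one G (insert x B₀) 2
  have hbound₃ : ∀ x ∈ K₃, (5 / 4 - 7 / 6 * D₁) / 3 ≤ wTwo M G (insert x B₀) 5 / nb M G (insert x B₀) 5 := by
    intro x hx
    rw [hK₃, Finset.mem_filter] at hx
    have hxG : x ∈ G := (Finset.mem_sdiff.1 hx.1).1
    have hxB : x ∉ B₀ := (Finset.mem_sdiff.1 hx.1).2
    refine le_trans ?_ (single_share_five_of_three hs hG hrG hB hxG hxB hx.2)
    have := hdemD x hx.1
    rw [div_le_div_iff_of_pos_right (by norm_num)]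
    linarith
  have hbound₄ : ∀ x ∈ K \ K₃, (5 / 3 - 7 / 6 * D₁) / 4 ≤ wTwo M G (insert x B₀) 5 / nb M G (insert x B₀) 5 := by
    intro x hx
    rw [Finset.mem_sdiff, hK₃, Finset.mem_filter] at hx
    have hxG : x ∈ G := (Finset.mem_sdiff.1 hx.1).1
    have hxB : x ∉ B₀ := (Finset.mem_sdiff.1 hx.1).2
    have h3 := three_le_card_fc hs ((mem_basesOf.1 hB).1.trans hG) (hG hxG) (indep_of_mem_basesOf hB)
      (mem_closure_of_mem_basesOf hG hrG hB hxG) hxB (Finset.card_pos.1 (by rw [(mem_basesOf.1 hB).2.2]; norm_num))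
    have h4 : 4 ≤ (fc M x B₀).card := by
      have : ¬ (fc M x B₀).card = 3 := fun h => hx.2 ⟨hx.1, h⟩
      omega
    refine le_trans ?_ (single_share_five_of_ge_four hs hG hrG hB hxG hxB h4)
    have := hdemD x hx.1
    rw [div_le_div_iff_of_pos_right (by norm_num)]
    linarith
  have hsplit := Finset.sum_sdiff (f := fun x => wTwo M G (insert x B₀) 5 / nb M G (insert x B₀) 5) hK₃K
  rw [← hsplit]
  have h₃ := Finset.card_nsmul_le_sum K₃ (fun x => wTwo M G (insert x B₀) 5 / nb M G (insert x B₀) 5)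
    ((5 / 4 - 7 / 6 * D₁) / 3) hbound₃
  have h₄ := Finset.card_nsmul_le_sum (K \ K₃) (fun x => wTwo M G (insert x B₀) 5 / nb M G (insert x B₀) 5)
    ((5 / 3 - 7 / 6 * D₁) / 4) hbound₄
  rw [nsmul_eq_mul] at h₃ h₄
  rw [Finset.card_sdiff_of_subset hK₃K] at h₄
  linarith

/-- **The pairs sum**: with `D₂ = 0` if `#K ≤ 3`, `1` otherwise, the pairs meeting `K₃` each charge at least
`(5/3 − (7/6)D₂)/13` (lines `≤ 3` points). -/
theorem pairs_sum_ge (hs : Simple M) (hline : ∀ L ∈ flatsQ M 2, L.card ≤ 3) {G B₀ : Finset α} (hG : G ⊆ gr M)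
    (hrG : M.eRk (G : Set α) = ((5 : ℕ) : ℕ∞)) (hB : B₀ ∈ basesOf M G 5) :
    ((((G \ B₀).powersetCard 2).filter
        (fun P => (P ∩ (G \ B₀).filter (fun x => (fc M x B₀).card = 3)).Nonempty)).card : ℚ) *
        ((5 / 3 - 7 / 6 * (if (G \ B₀).card ≤ 3 then (0 : ℚ) else 1)) / 13) ≤
      ∑ P ∈ (G \ B₀).powersetCard 2, wTwo M G (B₀ ∪ P) 5 / nb M G (B₀ ∪ P) 5 := by
  set K := G \ B₀ with hK
  set K₃ := K.filter (fun x => (fc M x B₀).card = 3) with hK₃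
  set D₂ : ℚ := if K.card ≤ 3 then 0 else 1 with hD₂
  set F := (K.powersetCard 2).filter (fun P => (P ∩ K₃).Nonempty) with hF
  calc (F.card : ℚ) * ((5 / 3 - 7 / 6 * D₂) / 13) = ∑ _P ∈ F, ((5 / 3 - 7 / 6 * D₂) / 13) := by
        rw [Finset.sum_const, nsmul_eq_mul]
    _ ≤ ∑ P ∈ F, wTwo M G (B₀ ∪ P) 5 / nb M G (B₀ ∪ P) 5 := by
        apply Finset.sum_le_sum
        intro P hP
        rw [hF, Finset.mem_filter] at hP
        obtain ⟨hPK, hPne⟩ := hP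
        obtain ⟨hPsub, hPc⟩ := Finset.mem_powersetCard.1 hPK
        obtain ⟨x, hx⟩ := hPne
        rw [Finset.mem_inter, hK₃, Finset.mem_filter] at hx
        obtain ⟨hxP, _, hcx⟩ := hx
        have hPe : (P.erase x).card = 1 := by rw [Finset.card_erase_of_mem hxP, hPc]
        obtain ⟨y, hy⟩ := Finset.card_eq_one.1 hPe
        have hyPe : y ∈ P.erase x := by rw [hy]; exact Finset.mem_singleton_self y
        have hyP : y ∈ P := Finset.mem_of_mem_erase hyPe
        have hxy : x ≠ y := fun h => (Finset.mem_erase.1 hyPe).1 h.symm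
        have hPxy : P = {x, y} := by rw [← Finset.insert_erase hxP, hy]
        have hxG : x ∈ G := (Finset.mem_sdiff.1 (hPsub hxP)).1
        have hxB : x ∉ B₀ := (Finset.mem_sdiff.1 (hPsub hxP)).2
        have hyG : y ∈ G := (Finset.mem_sdiff.1 (hPsub hyP)).1
        have hyB : y ∉ B₀ := (Finset.mem_sdiff.1 (hPsub hyP)).2
        have hsh := pair_share_ge_of_three hs hline hG hrG hB hxG hxB hyG hyB hxy hcx
        rw [hPxy, union_pair_eq_insert]
        refine le_trans ?_ hsh
        have hdem1 := dem_le_one (M := M) G (insert x (insert y B₀)) 2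
        have hdemD : dem M G 2 (insert x (insert y B₀)) ≤ D₂ := by
          rw [hD₂]
          split_ifs with hk
          · rw [dem_two_eq_zero_of_card_le_one]
            have : G \ insert x (insert y B₀) = (K.erase x).erase y := by
              ext e
              simp only [Finset.mem_sdiff, Finset.mem_insert, Finset.mem_erase, hK]
              tauto
            rw [this, Finset.card_erase_of_mem (Finset.mem_erase.2 ⟨hxy.symm, hPsub hyP⟩),
              Finset.card_erase_of_mem (hPsub hxP)]
            omega
          · exact hdem1
        rw [div_le_div_iff_of_pos_right (by norm_num)]
        linarith
    _ ≤ ∑ P ∈ K.powersetCard 2, wTwo M G (B₀ ∪ P) 5 / nb M G (B₀ ∪ P) 5 := by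
        apply Finset.sum_le_sum_of_subset_of_nonneg (Finset.filter_subset _ _)
        intro P hP _
        obtain ⟨hPsub, hPc⟩ := Finset.mem_powersetCard.1 hP
        obtain ⟨hR, hcard⟩ := union_mem_Rq hrG hB hPsub
        exact div_nonneg (wTwo_nonneg_of_card_ne hs hG (by norm_num) hR (by rw [hcard, hPc]; norm_num))
          (Nat.cast_nonneg _)

/-! ## The charge of a demanding basis is at least `1/3` -/

/-- The arithmetic of the two layers: `k = #K ∈ [2, 5]`, `k₃ = #K₃ ≤ k`, `N` pairs meeting `K₃`. -/
theorem charge_arith (k k₃ N : ℕ) (hk : 2 ≤ k) (hk5 : k ≤ 5) (hk₃ : k₃ ≤ k)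
    (hN : N + (k - k₃).choose 2 = k.choose 2) (d₁ d₂ : ℚ) (hd₁0 : 0 ≤ d₁)
    (hd₁1 : d₁ ≤ 1) (hd₂0 : 0 ≤ d₂) (hd₂1 : d₂ ≤ 1) (hd₁ : k ≤ 2 → d₁ = 0) (hd₂ : k ≤ 3 → d₂ = 0) :
    1 / 3 ≤ (k₃ : ℚ) * ((5 / 4 - 7 / 6 * d₁) / 3) + ((k - k₃ : ℕ) : ℚ) * ((5 / 3 - 7 / 6 * d₁) / 4) +
      (N : ℚ) * ((5 / 3 - 7 / 6 * d₂) / 13) := by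
  have hNeq : N = k.choose 2 - (k - k₃).choose 2 := by omega
  subst hNeq
  interval_cases k <;> interval_cases k₃ <;> norm_num [Nat.choose] at hd₁ hd₂ ⊢ <;>
    first | (subst hd₁; subst hd₂; norm_num) | (subst hd₂; linarith) | linarith

/-- **Every basis `B₀` of `G` with `2 ≤ #(G ∖ B₀) ≤ 5` is charged at least `1/3`** (lines `≤ 3` points). -/
theorem sevenFive_charge_ge (hs : Simple M) (hline : ∀ L ∈ flatsQ M 2, L.card ≤ 3) {G B₀ : Finset α}
    (hG : G ⊆ gr M) (hrG : M.eRk (G : Set α) = ((5 : ℕ) : ℕ∞)) (hB : B₀ ∈ basesOf M G 5)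
    (hk : 2 ≤ (G \ B₀).card) (hk5 : (G \ B₀).card ≤ 5) : 1 / 3 ≤ charge M G 5 B₀ := by
  have h₁ := singles_sum_ge hs hG hrG hB
  have h₂ := pairs_sum_ge hs hline hG hrG hB
  have h₃ := charge_ge_singles_add_pairs hs hG hrG hB (by norm_num)
  have hcount := card_pairs_meet (K := G \ B₀) (K₃ := (G \ B₀).filter (fun x => (fc M x B₀).card = 3))
    (Finset.filter_subset _ _)
  have hk₃ := Finset.card_le_card (Finset.filter_subset (fun x => (fc M x B₀).card = 3) (G \ B₀))
  have harith := charge_arith (G \ B₀).card ((G \ B₀).filter (fun x => (fc M x B₀).card = 3)).card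
    (((G \ B₀).powersetCard 2).filter
      (fun P => (P ∩ (G \ B₀).filter (fun x => (fc M x B₀).card = 3)).Nonempty)).card hk hk5 hk₃ hcount
    (if (G \ B₀).card ≤ 2 then (0 : ℚ) else 1) (if (G \ B₀).card ≤ 3 then (0 : ℚ) else 1)
    (by split_ifs <;> norm_num) (by split_ifs <;> norm_num) (by split_ifs <;> norm_num)
    (by split_ifs <;> norm_num) (fun h => by rw [if_pos h]) (fun h => by rw [if_pos h])
  linarith

/-! ## The `t = 2` clause -/

/-- **The type-`2` balance on every rank-`5` flat with at most `10` points when lines have `≤ 3` points.** -/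
theorem jq_two_nonneg_of_lines_five (hs : Simple M) (hline : ∀ L ∈ flatsQ M 2, L.card ≤ 3) {G : Finset α}
    (hG : G ∈ flatsQ M 5) (hcard : G.card ≤ 10) : 0 ≤ Jq M G 5 2 := by
  have hGg : G ⊆ gr M := (mem_flatsQ.1 hG).1
  have hrG : M.eRk (G : Set α) = ((5 : ℕ) : ℕ∞) := (mem_flatsQ.1 hG).2.2
  apply Jq_two_nonneg_of_charge
  intro B₀ hB
  obtain ⟨hBG, hr, hc⟩ := mem_basesOf.1 hB
  have hkc : (G \ B₀).card = G.card - 5 := by rw [Finset.card_sdiff_of_subset hBG, hc]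
  have hw : -(1 / 3 : ℚ) ≤ wTwo M G B₀ 5 := by
    unfold wTwo wInf
    have hm : mTr M B₀ ≤ 5 := mTr_le_of_eRk_eq (hBG.trans hGg) hr
    have hm' : (mTr M B₀ : ℚ) ≤ 5 := by exact_mod_cast hm
    have hwinf : (1 : ℚ) / 6 ≤ 1 / (1 + (mTr M B₀ : ℚ)) := one_div_le_one_div_of_le (by positivity) (by linarith)
    have hd := dem_le_one (M := M) G B₀ 2
    push_cast
    nlinarith
  by_cases hk : (G \ B₀).card ≤ 1
  · -- demand-free basis: both terms are nonnegative
    have hd0 : dem M G 2 B₀ = 0 := dem_two_eq_zero_of_card_le_one hk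
    have hw0 : 0 ≤ wTwo M G B₀ 5 := by
      unfold wTwo
      rw [hd0]
      have := wInf_pos (M := M) B₀
      push_cast
      nlinarith
    have hch : 0 ≤ charge M G 5 B₀ := by
      have := charge_ge_sum_of_subset (q := 5) hs hGg (by norm_num) B₀ (T := ∅) (Finset.empty_subset _)
      rwa [Finset.sum_empty] at this
    linarith
  · have hch := sevenFive_charge_ge hs hline hGg hrG hB (by omega) (by omega)
    linarith

/-- **THE `t = 2` CLAUSE OF THE `(7, 5)` RESIDUE ON THE CORE**: on every Core matroid (of any rank), every rank-`5`
flat with at most `10` points satisfies the type-`2` balance `0 ≤ Jq M G 5 2`. -/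
theorem jq_two_nonneg_of_core_five {γ : Type} [DecidableEq γ] {M : Matroid γ} [M.Finite] {p : ℕ} (hc : Core M p)
    {G : Finset γ} (hG : G ∈ flatsQ M 5) (hcard : G.card ≤ 10) : 0 ≤ Jq M G 5 2 :=
  jq_two_nonneg_of_lines_five (simple_of_core hc) (fun _ hL => card_le_three_of_line_of_core hc hL) hG hcard

/-- **The `t = 3` clause of the coloop-free low layers of `(7, 5)`** — the remaining open conjunct of
`SevenFiveLowLayersCoreFree` (night-2's R5′ / (J1) world). -/
def SevenFiveTypeThreeCoreFree : Prop :=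
  ∀ {β : Type} [DecidableEq β] (M : Matroid β) [M.Finite] (G : Finset β), Core M 7 → G ∈ flatsQ M 5 → mTr M G = 0 →
    0 ≤ Jq M G 5 3

/-- **The coloop-free low layers of `(7, 5)` are exactly their `t = 3` clause**: the `t = 2` clause is the kernel
theorem `jq_two_nonneg_of_core_five`. -/
theorem sevenFiveLowLayersCoreFree_of_typeThree (h3 : SevenFiveTypeThreeCoreFree) : SevenFiveLowLayersCoreFree := by
  intro β _ M _ G hc hG hm
  exact ⟨fun hcard => jq_two_nonneg_of_core_five hc hG hcard, h3 M G hc hG hm⟩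

/-- **C-025 at `(7, 5)` on every finite matroid from the trace sums, corners (ii), (iii) and the `t = 3` clause
of the coloop-free low layers on the core.** -/
theorem rls_seven_five_of_cornersFree' {α : Type} [DecidableEq α] (htr : SevenFiveTraceSumsCore)
    (h2 : SevenFiveCornerTwoCore) (h3 : SevenFiveCornerThreeCore) (hlow : SevenFiveTypeThreeCoreFree) (M : Matroid α)
    [M.Finite] : RLS M 7 5 :=
  rls_seven_five_of_cornersFree htr h2 h3 (sevenFiveLowLayersCoreFree_of_typeThree hlow) M

end PercRepro.GenQ
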